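import Literature.NumberTheory.EllipticCurves.ModularCurveEtaProductsProofs
import Mathlib.GroupTheory.Abelianization.Defs
import Mathlib.Data.ZMod.QuotientGroup
import Mathlib.RingTheory.RootsOfUnity.Complex
import HarnessLib

/-!
# `(Γ : Γ') = 12` for the modular group `Γ = SL₂(ℤ)` (Reiner 1955 §2), via the character of `η²`

I. Reiner, *Real linear characters of the symplectic modular group*, Proc. Amer. Math. Soc. **6** (1955) 987–990
(read in *Irving Reiner: Selected Works*, Univ. of Illinois Press 1989, pp. 92–95), §2. Lane `lit-hodgefound`,
prover seat p25, row g33-#3; the case `n = 1` (`Γ_2 = Sp_2(ℤ) = SL_2(ℤ)`) of the programme of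
`Literature/LinearAlgebra/Matrix/SymplecticIntegerCommutatorSubgroup.lean` (g33-#1, `n ≥ 3` and `n ≥ 2`) and
`SiegelModularGroupDegreeTwoCommutator.lean` (g33-#2, `n = 2`). ONE definition (`etaSqCharacter`, the character
of `η²` as a monoid homomorphism) and THEOREMS; no named fact, net debt `0`.

## The source, as printed (Reiner, §2, pp. 93–94 of the *Selected Works*)

> 2. Now we consider `Γ'_{2n}`, and we begin with `n = 1`, the most difficult case. The commutator subgroup of
> `Γ_2/{±I}` is known [5], but we shall not use this earlier result. According to [6], `Γ_2 = {S, T}` has as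
> defining relations `S⁴ = TS⁻¹TS⁻¹TS = 1`. Then the sum of the exponents to which `S` (resp. `T`) occurs in any
> relation, must be of the form `4a - b` (resp. `3b`) … Hence `X ∈ Γ'_2` if and only if (4) holds. Consequently
> `T¹² ∈ Γ'_2`, `T^m ∉ Γ'_2` for `m = 1, …, 11`, and we have `Γ_2 = ⋃_{m=0}^{11} T^m Γ_2'`. Thus³
> `(Γ_2 : Γ_2') = 12`. [³ This result has been obtained independently by Professor J. L. Brenner.]
> Next we show how `Γ_2'` may be defined by means of congruences … `Γ_2' = K_3 ∩ K_4`.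

## What is proved, and how

Mathlib's `S = (0 -1; 1 0)`, `T = (1 1; 0 1)` generate `SL(2, ℤ)` (`SpecialLinearGroup.SL2Z_generators`) and
satisfy `S² = -1 = (ST)³`, `S⁴ = 1` (§2, entrywise `rfl`). Hence (§2) every monoid homomorphism `φ` from `SL(2, ℤ)` to a
commutative monoid satisfies `φ(S) = φ(T)⁻³`, **`φ(T)¹² = 1`**, `φ(γ)¹² = 1`, and is determined by `φ(T)`
(`hom_ext_of_map_T_eq`) — Reiner's upper bound `T¹² ∈ Γ'`, `Γ = ⋃ T^m Γ'`, read off the relations instead of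
Nielsen's presentation. The lower bound `T^m ∉ Γ'` (`0 < m < 12`), for which Reiner needs the completeness of the
presentation, is obtained here from a character of order `12`: the tree's multiplier system of `η²`
(`Literature.NumberTheory.EllipticCurves.ModularForms.etaSq_slash_SL2`:
`η²|₁γ = e^{πi e(γ)/6} η²`, `e = etaSqExp`) is packaged (§1) as the monoid homomorphism

* **`etaSqCharacter : SL(2, ℤ) →* ℂ`**, `γ ↦ e^{πi e(γ)/6}` (multiplicative because `η² ≠ 0` and `|₁` is an
  action), with `etaSq_slash_eq_smul` (`η²|₁γ = χ_η²(γ) • η²`), `etaSqCharacter_T = e^{πi/6}` (a primitive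
  `12`-th root of unity, `orderOf_etaSqCharacter_T`), `etaSqCharacter_S = -i`, `etaSqCharacter_neg_one = -1`,
  `etaSqCharacter_pow_twelve`.

Main results (§3, namespace `Literature.NumberTheory.ModularForms.SL2Z`):

* **`index_commutator_eq_twelve`** — `(Γ : Γ') = 12` for `Γ = SL(2, ℤ)`; `card_abelianization_eq_twelve`;
  `zpowers_of_T_eq_top` and `orderOf_of_T` (the abelianization is cyclic of order `12`, generated by the class of
  `T` — "`Γ_2 = ⋃_{m=0}^{11} T^m Γ_2'`"); `T_zpow_mem_commutator_iff` (`T^m ∈ Γ' ↔ 12 ∣ m`),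
  `S_notMem_commutator`, `neg_one_notMem_commutator`;
* **`commutator_eq_ker_etaSqCharacter`** and `mem_commutator_iff_twelve_dvd_etaSqExp` — "`Γ_2'` defined by
  means of congruences": `γ = (a b; c d) ∈ Γ'` iff `12 ∣ (1 - c²)(bd + 3(c-1)d + c + 3) + c(a + d - 3)` (Reiner's
  own description `Γ_2' = K_3 ∩ K_4` through `SL_2(𝔽_3) ⊳ Q_8` and `SL_2(ℤ/4)` is not reproduced);
* `map_pow_twelve`, `hom_ext_of_map_T_eq` — every character of `SL(2, ℤ)` has order dividing `12` and is
  determined by its value at `T`.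
* §4 (row g33-#10; C. Marks 2010, Lemma 1.1 / **Corollary 1.2 as printed**: "The group `Hom(Γ, ℂ*)` is cyclic of order
  `12`, with generator `χ` satisfying `χ(T) = e(1/12)`, `χ(S) = e(-1/4)`, `χ(R) = e(1/3)`", `R = (-1 1; -1 0)`,
  `RS = T`): that `χ` is `χ_{η²}` — `etaSqCharacter_T_mul_S_inv` (`χ_{η²}(R) = e^{2πi/3}`, `R = T S⁻¹`,
  `coe_T_mul_S_inv`); **`orderOf_etaSqCharacter = 12`**, `etaSqCharacter_pow_eq_pow_iff`,
  **`exists_eq_etaSqCharacter_pow`** (every `χ : SL(2, ℤ) →* ℂ` is `χ_{η²}^k`, `k < 12`),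
  `existsUnique_eq_etaSqCharacter_pow`, `powers_etaSqCharacter_eq_top`, **`card_hom_complex = 12`**; for
  `ℂˣ`-valued characters (Mathlib `MonoidHom.toHomUnitsMulEquiv`): `zpowers_etaSqCharacter_toHomUnits_eq_top`,
  **`isCyclic_hom_units_complex`**, **`card_hom_units_complex : Nat.card (SL(2, ℤ) →* ℂˣ) = 12`**.

## References

* [Reiner1955RealLinearCharacters] I. Reiner, *Real linear characters of the symplectic modular group*, Proc.
  Amer. Math. Soc. 6 (1955), 987–990, §2.
* [DiamondShurman2005] F. Diamond, J. Shurman, *A first course in modular forms*, GTM 228, §1.2 (`η`, `η²⁴ = Δ`)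
  — the source of the tree's `etaSq_slash_SL2`.
* [Marks2010] C. Marks, *Classification of vector-valued modular forms of dimension less than six*, arXiv:1003.4111
  (2010), §1 Lemma 1.1, Corollary 1.2.
-/

noncomputable section

open UpperHalfPlane hiding I
open ModularForm Complex Matrix.SpecialLinearGroup
open scoped MatrixGroups Real ModularForm
open Literature.NumberTheory.EllipticCurves.ModularForms (etaSq etaSqExp etaSq_slash_SL2 etaSq_ne_zero
  etaSqExp_one cexp_pi_mul_I_div_six_pow_twelve cexp_pi_mul_I_div_six_mul_eq cexp_pi_mul_I_div_six_mul_nine)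

namespace Literature.NumberTheory.ModularForms.SL2Z

/-! ## §1. The character of `η²` as a monoid homomorphism `SL(2, ℤ) →* ℂ` -/

/-- The multiplier `e^{πi e(γ)/6}` of `η²` under `γ`, before packaging. [folklore] -/
private theorem mult_mul (γ δ : SL(2, ℤ)) :
    cexp (π * I / 6 * etaSqExp ((γ * δ) 0 0) ((γ * δ) 0 1) ((γ * δ) 1 0) ((γ * δ) 1 1)) =
      cexp (π * I / 6 * etaSqExp (γ 0 0) (γ 0 1) (γ 1 0) (γ 1 1)) *
        cexp (π * I / 6 * etaSqExp (δ 0 0) (δ 0 1) (δ 1 0) (δ 1 1)) := by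
  have h := etaSq_slash_SL2 (γ * δ)
  rw [SlashAction.slash_mul, etaSq_slash_SL2 γ, SL_smul_slash, etaSq_slash_SL2 δ, smul_smul] at h
  have hI := congrFun h UpperHalfPlane.I
  simp only [Pi.smul_apply, smul_eq_mul] at hI
  exact (mul_right_cancel₀ (etaSq_ne_zero _) hI).symm

/-- **The character of `η²`**: the monoid homomorphism `χ_{η²} : SL(2, ℤ) →* ℂ`,
`γ = (a b; c d) ↦ e^{πi e(γ)/6}` with `e(γ) = (1 - c²)(bd + 3(c-1)d + c + 3) + c(a + d - 3)`, the multiplier of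
`η²` in weight `1` (`etaSq_slash_eq_smul`); a character of order `12` with `T ↦ e^{πi/6}`, `S ↦ -i`.
[cite: Reiner1955RealLinearCharacters, §2] -/
def etaSqCharacter : SL(2, ℤ) →* ℂ where
  toFun γ := cexp (π * I / 6 * etaSqExp (γ 0 0) (γ 0 1) (γ 1 0) (γ 1 1))
  map_one' := by simp [etaSqExp_one]
  map_mul' := mult_mul

/-- Unfolding of `etaSqCharacter`: `χ_{η²}(γ) = e^{πi e(γ)/6}`. [cite: DiamondShurman2005, §1.2] -/
theorem etaSqCharacter_apply (γ : SL(2, ℤ)) :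
    etaSqCharacter γ = cexp (π * I / 6 * etaSqExp (γ 0 0) (γ 0 1) (γ 1 0) (γ 1 1)) := rfl

/-- **`η² |₁ γ = χ_{η²}(γ) • η²`** for every `γ ∈ SL(2, ℤ)` (the tree's `etaSq_slash_SL2`, repackaged).
[cite: DiamondShurman2005, §1.2] -/
theorem etaSq_slash_eq_smul (γ : SL(2, ℤ)) : etaSq ∣[(1 : ℤ)] γ = etaSqCharacter γ • etaSq :=
  etaSq_slash_SL2 γ

/-- `χ_{η²}(T) = e^{πi/6}`. [cite: DiamondShurman2005, §1.2] -/
theorem etaSqCharacter_T : etaSqCharacter ModularGroup.T = cexp (π * I / 6) := by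
  rw [etaSqCharacter_apply]
  simp [ModularGroup.coe_T, etaSqExp]

/-- `χ_{η²}(S) = -i`. [cite: DiamondShurman2005, §1.2] -/
theorem etaSqCharacter_S : etaSqCharacter ModularGroup.S = -I := by
  rw [etaSqCharacter_apply, ← cexp_pi_mul_I_div_six_mul_nine]
  have h : etaSqExp (ModularGroup.S 0 0) (ModularGroup.S 0 1) (ModularGroup.S 1 0) (ModularGroup.S 1 1) = -3 := by
    simp [ModularGroup.coe_S, etaSqExp]
  rw [h]
  exact cexp_pi_mul_I_div_six_mul_eq ⟨-1, by norm_num⟩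

/-- `χ_{η²}(-1) = -1` (so `χ_{η²}` does not factor through `PSL(2, ℤ)`). [cite: Reiner1955RealLinearCharacters, §2] -/
theorem etaSqCharacter_neg_one : etaSqCharacter (-1) = -1 := by
  rw [etaSqCharacter_apply]
  have h : etaSqExp ((-1 : SL(2, ℤ)) 0 0) ((-1 : SL(2, ℤ)) 0 1) ((-1 : SL(2, ℤ)) 1 0)
      ((-1 : SL(2, ℤ)) 1 1) = 6 := by
    simp [etaSqExp]
  rw [h, show (π * I / 6 * ((6 : ℤ) : ℂ) : ℂ) = π * I by push_cast; ring, Complex.exp_pi_mul_I]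

/-- `e^{πi/6} = e^{2πi/12}` is a primitive `12`-th root of unity. [folklore] -/
private theorem isPrimitiveRoot_cexp : IsPrimitiveRoot (cexp (π * I / 6)) 12 := by
  have h := Complex.isPrimitiveRoot_exp 12 (by norm_num)
  rwa [show (2 * π * I / (12 : ℕ) : ℂ) = π * I / 6 by push_cast; ring] at h

/-- **`χ_{η²}(T)` has order `12`.** [cite: Reiner1955RealLinearCharacters, §2] -/
theorem orderOf_etaSqCharacter_T : orderOf (etaSqCharacter ModularGroup.T) = 12 := by
  rw [etaSqCharacter_T]; exact (isPrimitiveRoot_cexp.eq_orderOf).symm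

/-- `χ_{η²}(γ) = ζ^{e(γ)}` with `ζ = e^{πi/6}`. [folklore] -/
private theorem etaSqCharacter_eq_zpow (γ : SL(2, ℤ)) :
    etaSqCharacter γ = cexp (π * I / 6) ^ etaSqExp (γ 0 0) (γ 0 1) (γ 1 0) (γ 1 1) := by
  rw [etaSqCharacter_apply, ← Complex.exp_int_mul, mul_comm]

/-- **`χ_{η²}¹² = 1`**: every value is a `12`-th root of unity. [cite: Reiner1955RealLinearCharacters, §2] -/
theorem etaSqCharacter_pow_twelve (γ : SL(2, ℤ)) : etaSqCharacter γ ^ 12 = 1 := by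
  rw [etaSqCharacter_eq_zpow, ← zpow_natCast, ← zpow_mul, zpow_mul', zpow_natCast,
    cexp_pi_mul_I_div_six_pow_twelve, one_zpow]

/-- `χ_{η²}(γ) = 1` iff `12 ∣ e(γ)` (`e^{πi/6}` is a primitive `12`-th root of unity). [cite: Reiner1955RealLinearCharacters, §2] -/
theorem etaSqCharacter_eq_one_iff (γ : SL(2, ℤ)) :
    etaSqCharacter γ = 1 ↔ (12 : ℤ) ∣ etaSqExp (γ 0 0) (γ 0 1) (γ 1 0) (γ 1 1) := by
  rw [etaSqCharacter_eq_zpow]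
  exact_mod_cast isPrimitiveRoot_cexp.zpow_eq_one_iff_dvd _

/-! ## §2. The relations `S² = -1 = (ST)³`, `S⁴ = 1` and their consequences for characters -/

/-- `S² = -1` in `SL(2, ℤ)`. [folklore] -/
private theorem S_mul_S : ModularGroup.S * ModularGroup.S = -1 := by
  ext i j; fin_cases i <;> fin_cases j <;> rfl

/-- `(ST)³ = -1` in `SL(2, ℤ)`. [folklore] -/
private theorem S_mul_T_pow_three : (ModularGroup.S * ModularGroup.T) ^ 3 = -1 := by
  ext i j; fin_cases i <;> fin_cases j <;> rfl

/-- `S⁴ = 1` in `SL(2, ℤ)`. [folklore] -/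
private theorem S_pow_four : ModularGroup.S ^ 4 = 1 := by
  ext i j; fin_cases i <;> fin_cases j <;> rfl

section Characters

variable {M : Type*} [CommMonoid M]

/-- For a homomorphism `ψ` to a commutative GROUP: `ψ(S) = ψ(T)⁻³` (from `(ST)³ = -1 = S²`). [folklore] -/
private theorem map_S_eq {A : Type*} [CommGroup A] (ψ : SL(2, ℤ) →* A) :
    ψ ModularGroup.S = (ψ ModularGroup.T)⁻¹ ^ 3 := by
  have h3 : (ψ ModularGroup.S * ψ ModularGroup.T) ^ 3 = ψ ModularGroup.S ^ 2 := by
    rw [← map_mul, ← map_pow, S_mul_T_pow_three, sq, ← map_mul, S_mul_S]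
  rw [mul_pow, pow_succ (ψ ModularGroup.S) 2, mul_assoc] at h3
  have h := mul_left_cancel (h3.trans (mul_one _).symm)
  rw [inv_pow, eq_inv_iff_mul_eq_one]
  exact h

/-- For a homomorphism `ψ` to a commutative GROUP: `ψ(T)¹² = 1` (from `S⁴ = 1` and `ψ(S) = ψ(T)⁻³`).
[folklore] -/
private theorem map_T_pow_twelve_aux {A : Type*} [CommGroup A] (ψ : SL(2, ℤ) →* A) :
    ψ ModularGroup.T ^ 12 = 1 := by
  have h4 : ψ ModularGroup.S ^ 4 = 1 := by rw [← map_pow, S_pow_four, map_one]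
  rw [map_S_eq, ← pow_mul, inv_pow, inv_eq_one] at h4
  exact h4

/-- **A character of `SL(2, ℤ)` is determined by its value at `T`**: two monoid homomorphisms to a commutative
monoid that agree at `T = (1 1; 0 1)` are equal (`S ↦ φ(T)⁻³` is forced by `(ST)³ = S²`, and `S, T` generate).
[cite: Reiner1955RealLinearCharacters, §2] -/
theorem hom_ext_of_map_T_eq (φ φ' : SL(2, ℤ) →* M) (h : φ ModularGroup.T = φ' ModularGroup.T) : φ = φ' := by
  suffices hu : φ.toHomUnits = φ'.toHomUnits by
    ext g
    rw [← MonoidHom.coe_toHomUnits φ g, ← MonoidHom.coe_toHomUnits φ' g, hu]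
  have hT : φ.toHomUnits ModularGroup.T = φ'.toHomUnits ModularGroup.T := Units.ext h
  refine MonoidHom.eq_of_eqOn_dense SpecialLinearGroup.SL2Z_generators ?_
  rintro g (rfl | rfl)
  · change φ.toHomUnits ModularGroup.S = φ'.toHomUnits ModularGroup.S
    rw [map_S_eq, map_S_eq, hT]
  · exact hT

/-- **`φ(T)¹² = 1`** for every monoid homomorphism from `SL(2, ℤ)` to a commutative monoid ("`T¹² ∈ Γ'_2`").
[cite: Reiner1955RealLinearCharacters, §2] -/
theorem map_T_pow_twelve (φ : SL(2, ℤ) →* M) : φ ModularGroup.T ^ 12 = 1 := by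
  have h := map_T_pow_twelve_aux φ.toHomUnits
  rw [← MonoidHom.coe_toHomUnits φ, ← Units.val_pow_eq_pow_val, h, Units.val_one]

/-- **Every character of `SL(2, ℤ)` has order dividing `12`**: `φ(γ)¹² = 1` for every monoid homomorphism to a
commutative monoid and every `γ`. [cite: Reiner1955RealLinearCharacters, §2] -/
theorem map_pow_twelve (φ : SL(2, ℤ) →* M) (γ : SL(2, ℤ)) : φ γ ^ 12 = 1 := by
  have h : φ ^ 12 = 1 := hom_ext_of_map_T_eq _ _ (by rw [MonoidHom.pow_apply, MonoidHom.one_apply, map_T_pow_twelve])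
  rw [← MonoidHom.pow_apply, h, MonoidHom.one_apply]

end Characters

/-! ## §3. `(Γ : Γ') = 12`: the abelianization of `SL(2, ℤ)` is cyclic of order `12`, generated by `T` -/

/-- **The abelianization of `SL(2, ℤ)` is generated by the class of `T`** ("`Γ_2 = ⋃_m T^m Γ_2'`").
[cite: Reiner1955RealLinearCharacters, §2] -/
theorem zpowers_of_T_eq_top : Subgroup.zpowers (Abelianization.of (ModularGroup.T : SL(2, ℤ))) = ⊤ := by
  set B := Subgroup.zpowers (Abelianization.of (ModularGroup.T : SL(2, ℤ)))
  have hcomp : (QuotientGroup.mk' B).comp Abelianization.of = 1 :=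
    hom_ext_of_map_T_eq _ _ (by
      rw [MonoidHom.comp_apply, MonoidHom.one_apply, QuotientGroup.mk'_apply, QuotientGroup.eq_one_iff]
      exact Subgroup.mem_zpowers _)
  rw [eq_top_iff]
  intro x _
  obtain ⟨g, rfl⟩ := QuotientGroup.mk_surjective x
  have hx := DFunLike.congr_fun hcomp g
  rw [MonoidHom.comp_apply, MonoidHom.one_apply, QuotientGroup.mk'_apply, QuotientGroup.eq_one_iff] at hx
  exact hx

/-- **The class of `T` in `SL(2, ℤ)/SL(2, ℤ)'` has order exactly `12`**: at most `12` by the relations, at least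
`12` because `χ_{η²}(T) = e^{πi/6}` has order `12` ("`T¹² ∈ Γ_2'`, `T^m ∉ Γ_2'` for `m = 1, …, 11`").
[cite: Reiner1955RealLinearCharacters, §2] -/
theorem orderOf_of_T : orderOf (Abelianization.of (ModularGroup.T : SL(2, ℤ))) = 12 := by
  apply Nat.dvd_antisymm (orderOf_dvd_of_pow_eq_one (map_T_pow_twelve _))
  have h := orderOf_map_dvd (Abelianization.lift etaSqCharacter.toHomUnits) (Abelianization.of ModularGroup.T)
  rwa [Abelianization.lift_apply_of, ← orderOf_units, MonoidHom.coe_toHomUnits, orderOf_etaSqCharacter_T] at h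

/-- `T^m ∈ Γ'` iff `12 ∣ m`. [cite: Reiner1955RealLinearCharacters, §2] -/
theorem T_zpow_mem_commutator_iff (m : ℤ) :
    (ModularGroup.T : SL(2, ℤ)) ^ m ∈ commutator SL(2, ℤ) ↔ (12 : ℤ) ∣ m := by
  rw [← Abelianization.ker_of, MonoidHom.mem_ker, map_zpow, ← orderOf_dvd_iff_zpow_eq_one, orderOf_of_T,
    Nat.cast_ofNat]

/-- **`|SL(2, ℤ)^{ab}| = 12`.** [cite: Reiner1955RealLinearCharacters, §2] -/
theorem card_abelianization_eq_twelve : Nat.card (Abelianization SL(2, ℤ)) = 12 := by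
  rw [← Subgroup.card_top, ← zpowers_of_T_eq_top, Nat.card_zpowers, orderOf_of_T]

/-- **Reiner: `(Γ_2 : Γ_2') = 12`** — the commutator subgroup of the modular group `SL(2, ℤ)` has index `12`.
[cite: Reiner1955RealLinearCharacters, §2] -/
theorem index_commutator_eq_twelve : (commutator SL(2, ℤ)).index = 12 := by
  rw [Subgroup.index_eq_card]; exact card_abelianization_eq_twelve

/-- The commutator subgroup lies in the kernel of every monoid homomorphism to a commutative monoid.
[folklore] -/
private theorem commutator_le_ker {G : Type*} [Group G] {M : Type*} [CommMonoid M] (φ : G →* M) :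
    commutator G ≤ φ.ker := by
  rw [commutator_eq_closure, Subgroup.closure_le]
  rintro _ ⟨x, y, rfl⟩
  rw [SetLike.mem_coe, MonoidHom.mem_ker, ← MonoidHom.coe_toHomUnits φ, map_commutatorElement,
    (Commute.all _ _).commutator_eq, Units.val_one]

/-- **`Γ' = ker χ_{η²}`**: the commutator subgroup of `SL(2, ℤ)` is the kernel of the character of `η²` (a
character of order `12 = (Γ : Γ')`). [cite: Reiner1955RealLinearCharacters, §2] -/
theorem commutator_eq_ker_etaSqCharacter : commutator SL(2, ℤ) = etaSqCharacter.ker := by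
  refine le_antisymm (commutator_le_ker _) fun g hg => ?_
  rw [MonoidHom.mem_ker] at hg
  have hmem : Abelianization.of g ∈ Subgroup.zpowers (Abelianization.of (ModularGroup.T : SL(2, ℤ))) := by
    rw [zpowers_of_T_eq_top]; exact Subgroup.mem_top _
  obtain ⟨k, hk⟩ := Subgroup.mem_zpowers_iff.mp hmem
  have h1 : etaSqCharacter.toHomUnits ModularGroup.T ^ k = 1 := by
    rw [← Abelianization.lift_apply_of (f := etaSqCharacter.toHomUnits), ← map_zpow, hk,
      Abelianization.lift_apply_of]
    exact Units.ext hg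
  have h12 : ((orderOf (etaSqCharacter.toHomUnits ModularGroup.T) : ℕ) : ℤ) ∣ k :=
    orderOf_dvd_iff_zpow_eq_one.mpr h1
  rw [← orderOf_units, MonoidHom.coe_toHomUnits, orderOf_etaSqCharacter_T] at h12
  rw [← Abelianization.ker_of, MonoidHom.mem_ker, ← hk, ← orderOf_dvd_iff_zpow_eq_one, orderOf_of_T]
  exact h12

/-- **`Γ'` by congruences**: `γ = (a b; c d) ∈ SL(2, ℤ)'` iff `12 ∣ (1 - c²)(bd + 3(c-1)d + c + 3) + c(a + d - 3)`.
[cite: Reiner1955RealLinearCharacters, §2] -/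
theorem mem_commutator_iff_twelve_dvd_etaSqExp (γ : SL(2, ℤ)) :
    γ ∈ commutator SL(2, ℤ) ↔ (12 : ℤ) ∣ etaSqExp (γ 0 0) (γ 0 1) (γ 1 0) (γ 1 1) := by
  rw [commutator_eq_ker_etaSqCharacter, MonoidHom.mem_ker, etaSqCharacter_eq_one_iff]

/-- `S ∉ SL(2, ℤ)'` (`e(S) = -3`). [cite: Reiner1955RealLinearCharacters, §2] -/
theorem S_notMem_commutator : (ModularGroup.S : SL(2, ℤ)) ∉ commutator SL(2, ℤ) := by
  rw [mem_commutator_iff_twelve_dvd_etaSqExp]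
  simp [ModularGroup.coe_S, etaSqExp]

/-- `-1 ∉ SL(2, ℤ)'` (`e(-1) = 6`; by Reiner's criterion (4): `-1 = S²` has exponent sums `(2, 0)`, not of the form
`(4a - b, 3b)`). [cite: Reiner1955RealLinearCharacters, §2] -/
theorem neg_one_notMem_commutator : (-1 : SL(2, ℤ)) ∉ commutator SL(2, ℤ) := by
  rw [mem_commutator_iff_twelve_dvd_etaSqExp]
  simp [etaSqExp]

/-! ## §4. `Hom(Γ, ℂ^×)` is cyclic of order `12`, generated by `χ = χ_{η²}` (Marks 2010, Corollary 1.2) -/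

section CharacterGroup

/-- Marks's `R = (-1 1; -1 0)` is `T S⁻¹` (`RS = T`). [cite: Marks2010, §1 (1)] -/
theorem coe_T_mul_S_inv :
    ((ModularGroup.T * ModularGroup.S⁻¹ : SL(2, ℤ)) : Matrix (Fin 2) (Fin 2) ℤ) = !![-1, 1; -1, 0] := by
  rw [Matrix.SpecialLinearGroup.coe_mul, Matrix.SpecialLinearGroup.coe_inv, ModularGroup.coe_T, ModularGroup.coe_S]
  decide

/-- `R³ = 1` for `R = T S⁻¹ = (-1 1; -1 0)`. [cite: Marks2010, §1 (1)] -/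
theorem T_mul_S_inv_pow_three : (ModularGroup.T * ModularGroup.S⁻¹ : SL(2, ℤ)) ^ 3 = 1 := by
  apply Subtype.ext
  rw [Matrix.SpecialLinearGroup.coe_pow, coe_T_mul_S_inv, Matrix.SpecialLinearGroup.coe_one]
  decide

/-- **`χ_{η²}(R) = e(1/3) = e^{2πi/3}`** for `R = T S⁻¹ = (-1 1; -1 0)` (`e(R) = 4`): with `χ_{η²}(T) = e(1/12)` and
`χ_{η²}(S) = e(-1/4) = -i` these are the three printed values of Marks's generator `χ` of `Hom(Γ, ℂ*)`.
[cite: Marks2010, Cor. 1.2] -/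
theorem etaSqCharacter_T_mul_S_inv :
    etaSqCharacter (ModularGroup.T * ModularGroup.S⁻¹) = cexp (2 * π * I / 3) := by
  rw [etaSqCharacter_apply]
  have h : etaSqExp ((ModularGroup.T * ModularGroup.S⁻¹ : SL(2, ℤ)) 0 0) ((ModularGroup.T * ModularGroup.S⁻¹ : SL(2, ℤ)) 0 1)
      ((ModularGroup.T * ModularGroup.S⁻¹ : SL(2, ℤ)) 1 0) ((ModularGroup.T * ModularGroup.S⁻¹ : SL(2, ℤ)) 1 1) = 4 := by
    simp only [coe_T_mul_S_inv]
    simp [etaSqExp]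
  rw [h]
  congr 1
  push_cast
  ring

/-- **`χ_{η²}` has order `12`** in the monoid of `ℂ`-valued characters of `SL(2, ℤ)`. [cite: Marks2010, Cor. 1.2] -/
theorem orderOf_etaSqCharacter : orderOf etaSqCharacter = 12 := by
  refine Nat.dvd_antisymm (orderOf_dvd_of_pow_eq_one ?_) ?_
  · ext γ
    rw [MonoidHom.pow_apply, etaSqCharacter_pow_twelve, MonoidHom.one_apply]
  · have h : orderOf (etaSqCharacter ModularGroup.T) ∣ orderOf etaSqCharacter := by
      apply orderOf_dvd_of_pow_eq_one
      rw [← MonoidHom.pow_apply, pow_orderOf_eq_one, MonoidHom.one_apply]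
    rwa [orderOf_etaSqCharacter_T] at h

/-- `χ_{η²}^a = χ_{η²}^b ↔ a ≡ b (mod 12)`. [cite: Marks2010, Cor. 1.2] -/
theorem etaSqCharacter_pow_eq_pow_iff (a b : ℕ) : etaSqCharacter ^ a = etaSqCharacter ^ b ↔ a ≡ b [MOD 12] := by
  have hfin : IsOfFinOrder etaSqCharacter := orderOf_pos_iff.1 (by rw [orderOf_etaSqCharacter]; norm_num)
  rw [hfin.pow_eq_pow_iff_modEq, orderOf_etaSqCharacter]

/-- **Every character `χ : SL(2, ℤ) → ℂ` is a power `χ_{η²}^k`, `0 ≤ k < 12`** (`χ(T)` is a `12`-th root of unity,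
`χ(T) = e^{πik/6}`, and a character is determined by `χ(T)`). [cite: Marks2010, Cor. 1.2] -/
theorem exists_eq_etaSqCharacter_pow (χ : SL(2, ℤ) →* ℂ) : ∃ k < 12, χ = etaSqCharacter ^ k := by
  obtain ⟨k, hk, hkT⟩ := isPrimitiveRoot_cexp.eq_pow_of_pow_eq_one (map_T_pow_twelve χ)
  exact ⟨k, hk, hom_ext_of_map_T_eq _ _ (by rw [MonoidHom.pow_apply, etaSqCharacter_T, hkT])⟩

/-- The exponent is unique modulo `12`. [cite: Marks2010, Cor. 1.2] -/
theorem existsUnique_eq_etaSqCharacter_pow (χ : SL(2, ℤ) →* ℂ) : ∃! k : ℕ, k < 12 ∧ χ = etaSqCharacter ^ k := by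
  obtain ⟨k, hk, rfl⟩ := exists_eq_etaSqCharacter_pow χ
  refine ⟨k, ⟨hk, rfl⟩, fun j hj => ?_⟩
  exact ((etaSqCharacter_pow_eq_pow_iff j k).1 hj.2.symm).eq_of_lt_of_lt hj.1 hk

/-- **`Hom(Γ, ℂ) = ⟨χ_{η²}⟩`** as a monoid. [cite: Marks2010, Cor. 1.2] -/
theorem powers_etaSqCharacter_eq_top : Submonoid.powers etaSqCharacter = ⊤ := by
  rw [eq_top_iff]
  intro χ _
  obtain ⟨k, -, rfl⟩ := exists_eq_etaSqCharacter_pow χ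
  exact ⟨k, rfl⟩

/-- **`|Hom(Γ, ℂ)| = 12`** (`ℂ`-valued monoid homomorphisms). [cite: Marks2010, Cor. 1.2] -/
theorem card_hom_complex : Nat.card (SL(2, ℤ) →* ℂ) = 12 := by
  have hbij : Function.Bijective fun k : Fin 12 => etaSqCharacter ^ (k : ℕ) := by
    constructor
    · intro a b hab
      exact Fin.ext (((etaSqCharacter_pow_eq_pow_iff a b).1 hab).eq_of_lt_of_lt a.2 b.2)
    · intro χ
      obtain ⟨k, hk, rfl⟩ := exists_eq_etaSqCharacter_pow χ
      exact ⟨⟨k, hk⟩, rfl⟩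
  rw [← Nat.card_eq_of_bijective _ hbij, Nat.card_eq_fintype_card, Fintype.card_fin]

/-- **`Hom(Γ, ℂ*) = ⟨χ_{η²}⟩`** as a group: every `ℂˣ`-valued character is an integral power of `χ_{η²}`.
[cite: Marks2010, Cor. 1.2] -/
theorem zpowers_etaSqCharacter_toHomUnits_eq_top : Subgroup.zpowers etaSqCharacter.toHomUnits = ⊤ := by
  rw [eq_top_iff]
  intro ψ _
  obtain ⟨k, -, hk⟩ := exists_eq_etaSqCharacter_pow (MonoidHom.toHomUnitsMulEquiv.symm ψ)
  have h1 : MonoidHom.toHomUnitsMulEquiv.symm etaSqCharacter.toHomUnits = etaSqCharacter :=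
    MonoidHom.toHomUnitsMulEquiv.symm_apply_apply etaSqCharacter
  have hψ : ψ = etaSqCharacter.toHomUnits ^ k := by
    apply MonoidHom.toHomUnitsMulEquiv.symm.injective
    rw [hk, map_pow, h1]
  rw [hψ]
  exact Subgroup.npow_mem_zpowers _ k

/-- Every `ℂˣ`-valued character of `SL(2, ℤ)` is an integral power of `χ_{η²}`. [cite: Marks2010, Cor. 1.2] -/
theorem mem_zpowers_etaSqCharacter_toHomUnits (ψ : SL(2, ℤ) →* ℂˣ) :
    ψ ∈ Subgroup.zpowers etaSqCharacter.toHomUnits := by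
  rw [zpowers_etaSqCharacter_toHomUnits_eq_top]; exact Subgroup.mem_top ψ

/-- **Marks, Corollary 1.2: `Hom(Γ, ℂ*)` is cyclic**, generated by `χ_{η²}`. [cite: Marks2010, Cor. 1.2] -/
theorem isCyclic_hom_units_complex : IsCyclic (SL(2, ℤ) →* ℂˣ) :=
  ⟨⟨etaSqCharacter.toHomUnits, mem_zpowers_etaSqCharacter_toHomUnits⟩⟩

/-- **Marks, Corollary 1.2: `|Hom(Γ, ℂ*)| = 12`.** [cite: Marks2010, Cor. 1.2] -/
theorem card_hom_units_complex : Nat.card (SL(2, ℤ) →* ℂˣ) = 12 := by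
  rw [← card_hom_complex]
  exact Nat.card_congr MonoidHom.toHomUnitsMulEquiv.symm.toEquiv

end CharacterGroup

end Literature.NumberTheory.ModularForms.SL2Z

end
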